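import Mathlib

/-!
# Conductors of characters along a decreasing filtration: the elementary arithmetic
(kernel witness for the [A]-steps «a product of two characters of different conductors has the
larger conductor», «a(ξ⁻¹) = a(ξ)», «a(ξγ) ≤ max(a(ξ), a(γ))» used in the local lemmas of the
toric-period section — Theorem N5.T2′ (iii-inert)′, Lemma N5.L6, Corollary N5.C1)

Setting: a group `G` with an antitone filtration by subgroups `U : ℕ → Subgroup G`
(for `G = E_v^×` or `𝒪_{E_v}^×`: `U n = U_E^n`, the higher unit groups of
`T5PrincipalUnitFiltration`), and characters `χ : G →* M` into a commutative monoid `M`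
(for unitary characters `M = Circle`).  The **conductor** `a(χ)` is the least `n` with
`U n ≤ ker χ` (`conductor`; junk value `0` when no such `n` exists — a smooth character always has
one, hypothesis `∃ n, U n ≤ χ.ker`, written out in every statement that needs it).

* `le_ker_of_conductor_le`, `not_le_ker_of_lt_conductor` — the defining property of `a(χ)`;
* `conductor_inv` — `a(χ⁻¹) = a(χ)`;
* `conductor_mul_le` — `a(χ₁χ₂) ≤ max (a(χ₁), a(χ₂))`;
* `conductor_mul_eq_of_lt` — **`a(χ₂) < a(χ₁) ⇒ a(χ₁χ₂) = a(χ₁)`**;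
* `conductor_mul_eq_of_ne` — `a(χ₁) ≠ a(χ₂) ⇒ a(χ₁χ₂) = max (a(χ₁), a(χ₂))`;
* `conductor_eq_zero_iff` — `a(χ) = 0 ↔ U 0 ≤ ker χ` («unramified» when `U 0 = 𝒪^×`).

Not modelled: the local field, the specific filtration (see `T5PrincipalUnitFiltration`).
Mathlib-only; axioms standard.  Uses an L-value-free non-vanishing device: NO (README §8(d)).
-/

namespace Summit.Ventures.HodgeRepro2.T5ConductorArithmetic

variable {G M : Type*} [Group G] [CommMonoid M]

/-- The conductor of `χ` along the filtration `U`: the least `n` with `U n ≤ ker χ`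
(junk value `0` if there is none). -/
noncomputable def conductor (U : ℕ → Subgroup G) (χ : G →* M) : ℕ :=
  sInf {n | U n ≤ χ.ker}

variable {U : ℕ → Subgroup G}

/-- `χ` is trivial on `U (a(χ))`. -/
theorem le_ker_conductor {χ : G →* M} (h : ∃ n, U n ≤ χ.ker) : U (conductor U χ) ≤ χ.ker :=
  Nat.sInf_mem h

/-- `χ` is trivial on `U n` for every `n ≥ a(χ)` (antitone filtration). -/
theorem le_ker_of_conductor_le (hU : Antitone U) {χ : G →* M} (h : ∃ n, U n ≤ χ.ker) {n : ℕ}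
    (hn : conductor U χ ≤ n) : U n ≤ χ.ker :=
  (hU hn).trans (le_ker_conductor h)

/-- `χ` is not trivial on `U n` for `n < a(χ)`. -/
theorem not_le_ker_of_lt_conductor {χ : G →* M} {n : ℕ} (hn : n < conductor U χ) :
    ¬ U n ≤ χ.ker :=
  Nat.notMem_of_lt_sInf hn

/-- `a(χ) ≤ n` as soon as `χ` is trivial on `U n`. -/
theorem conductor_le_of_le_ker {χ : G →* M} {n : ℕ} (hn : U n ≤ χ.ker) : conductor U χ ≤ n :=
  Nat.sInf_le hn

/-- `a(χ) ≤ n ↔ χ` is trivial on `U n` (antitone filtration, `χ` with a conductor). -/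
theorem conductor_le_iff (hU : Antitone U) {χ : G →* M} (h : ∃ n, U n ≤ χ.ker) {n : ℕ} :
    conductor U χ ≤ n ↔ U n ≤ χ.ker :=
  ⟨le_ker_of_conductor_le hU h, conductor_le_of_le_ker⟩

/-- `a(χ) = 0 ↔ χ` is trivial on `U 0` («unramified»). -/
theorem conductor_eq_zero_iff (hU : Antitone U) {χ : G →* M} (h : ∃ n, U n ≤ χ.ker) :
    conductor U χ = 0 ↔ U 0 ≤ χ.ker := by
  rw [← Nat.le_zero, conductor_le_iff hU h]

section Group

variable {M : Type*} [CommGroup M]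

/-- The kernel of `χ⁻¹` is the kernel of `χ`. -/
theorem ker_inv (χ : G →* M) : (χ⁻¹).ker = χ.ker := by
  ext g
  simp [MonoidHom.mem_ker]

/-- `a(χ⁻¹) = a(χ)`. -/
theorem conductor_inv (χ : G →* M) : conductor U χ⁻¹ = conductor U χ := by
  simp only [conductor, ker_inv]

/-- `χ⁻¹` has a conductor iff `χ` has one. -/
theorem exists_le_ker_inv_iff (χ : G →* M) : (∃ n, U n ≤ (χ⁻¹).ker) ↔ ∃ n, U n ≤ χ.ker := by
  simp only [ker_inv]

end Group

/-- If `χ₁` and `χ₂` are trivial on `U n`, so is `χ₁χ₂`. -/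
theorem le_ker_mul {χ₁ χ₂ : G →* M} {n : ℕ} (h₁ : U n ≤ χ₁.ker) (h₂ : U n ≤ χ₂.ker) :
    U n ≤ (χ₁ * χ₂).ker := by
  intro g hg
  rw [MonoidHom.mem_ker, MonoidHom.mul_apply, MonoidHom.mem_ker.mp (h₁ hg),
    MonoidHom.mem_ker.mp (h₂ hg), one_mul]

/-- A product of two characters with conductors has a conductor. -/
theorem exists_le_ker_mul (hU : Antitone U) {χ₁ χ₂ : G →* M} (h₁ : ∃ n, U n ≤ χ₁.ker)
    (h₂ : ∃ n, U n ≤ χ₂.ker) : ∃ n, U n ≤ (χ₁ * χ₂).ker := by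
  obtain ⟨n₁, hn₁⟩ := h₁
  obtain ⟨n₂, hn₂⟩ := h₂
  exact ⟨max n₁ n₂, le_ker_mul ((hU (le_max_left _ _)).trans hn₁)
    ((hU (le_max_right _ _)).trans hn₂)⟩

/-- **`a(χ₁χ₂) ≤ max (a(χ₁), a(χ₂))`.** -/
theorem conductor_mul_le (hU : Antitone U) {χ₁ χ₂ : G →* M} (h₁ : ∃ n, U n ≤ χ₁.ker)
    (h₂ : ∃ n, U n ≤ χ₂.ker) :
    conductor U (χ₁ * χ₂) ≤ max (conductor U χ₁) (conductor U χ₂) :=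
  conductor_le_of_le_ker (le_ker_mul
    (le_ker_of_conductor_le hU h₁ (le_max_left _ _))
    (le_ker_of_conductor_le hU h₂ (le_max_right _ _)))

section Group

variable {M : Type*} [CommGroup M]

/-- **A product of two characters of different conductors has the larger conductor**:
`a(χ₂) < a(χ₁) ⇒ a(χ₁χ₂) = a(χ₁)`.  Proof: `≤` by `conductor_mul_le`; if `a(χ₁χ₂) < a(χ₁)`
then on `U (a(χ₁) − 1)` both `χ₁χ₂` and `χ₂` are trivial, hence so is `χ₁ = (χ₁χ₂)χ₂⁻¹`,
contradicting the minimality of `a(χ₁)`. -/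
theorem conductor_mul_eq_of_lt (hU : Antitone U) {χ₁ χ₂ : G →* M} (h₁ : ∃ n, U n ≤ χ₁.ker)
    (h₂ : ∃ n, U n ≤ χ₂.ker) (hlt : conductor U χ₂ < conductor U χ₁) :
    conductor U (χ₁ * χ₂) = conductor U χ₁ := by
  refine le_antisymm ((conductor_mul_le hU h₁ h₂).trans (max_le le_rfl hlt.le)) ?_
  by_contra hcon
  rw [not_le] at hcon
  -- `n := a(χ₁) − 1`: `χ₁χ₂` and `χ₂` are trivial on `U n`
  set n := conductor U χ₁ - 1 with hn
  have hn1 : n < conductor U χ₁ := by omega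
  have hmul : U n ≤ (χ₁ * χ₂).ker :=
    le_ker_of_conductor_le hU (exists_le_ker_mul hU h₁ h₂) (by omega)
  have hχ₂ : U n ≤ χ₂.ker := le_ker_of_conductor_le hU h₂ (by omega)
  apply not_le_ker_of_lt_conductor hn1
  intro g hg
  have e1 := MonoidHom.mem_ker.mp (hmul hg)
  have e2 := MonoidHom.mem_ker.mp (hχ₂ hg)
  rw [MonoidHom.mul_apply, e2, mul_one] at e1
  exact MonoidHom.mem_ker.mpr e1

/-- `a(χ₁) ≠ a(χ₂) ⇒ a(χ₁χ₂) = max (a(χ₁), a(χ₂))`. -/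
theorem conductor_mul_eq_of_ne (hU : Antitone U) {χ₁ χ₂ : G →* M} (h₁ : ∃ n, U n ≤ χ₁.ker)
    (h₂ : ∃ n, U n ≤ χ₂.ker) (hne : conductor U χ₁ ≠ conductor U χ₂) :
    conductor U (χ₁ * χ₂) = max (conductor U χ₁) (conductor U χ₂) := by
  rcases lt_or_gt_of_ne hne with h | h
  · rw [mul_comm, conductor_mul_eq_of_lt hU h₂ h₁ h, max_eq_right h.le]
  · rw [conductor_mul_eq_of_lt hU h₁ h₂ h, max_eq_left h.le]

/-- The form used in (iii-inert)′: `a(ξ) < a(γ) ⇒ a(ξγ) = a(γ)` and `a(ξγ⁻¹) = a(γ)`. -/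
theorem conductor_mul_eq_and_conductor_mul_inv_eq (hU : Antitone U) {ξ γ : G →* M}
    (hξ : ∃ n, U n ≤ ξ.ker) (hγ : ∃ n, U n ≤ γ.ker) (hlt : conductor U ξ < conductor U γ) :
    conductor U (ξ * γ) = conductor U γ ∧ conductor U (ξ * γ⁻¹) = conductor U γ := by
  constructor
  · rw [mul_comm]
    exact conductor_mul_eq_of_lt hU hγ hξ hlt
  · rw [mul_comm, conductor_mul_eq_of_lt hU ((exists_le_ker_inv_iff γ).mpr hγ) hξ
      (by rwa [conductor_inv]), conductor_inv]

end Group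

end Summit.Ventures.HodgeRepro2.T5ConductorArithmetic
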